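import Summits.HodgeConjecture.HodgeConjecture.Theorems.Ring2HypothesesFlatSectionsQP
import Summits.HodgeConjecture.HodgeConjecture.Theorems.AnchorTransportVariationalHodgeQuasiProjective
import Literature.AlgebraicGeometry.HodgeTheory.DirectImageBaseChangeContinuous
import Literature.AlgebraicGeometry.HodgeTheory.InvariantClassesFromTotalSpaceHolds
import HarnessLib

/-!
# Ring 2 — hypotheses layer: the flat-section form of Conj. 11.3.1 reduces to affine bases; `VHC` gives it for quasi-projective total spaces over ANY smooth irreducible base

HONEST FRAMING: research route conditional on HC_CM; not a corollary; Q11.4-sentence-2 already refuted in dim ≥ 3.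

Cell `pub-hodge-ring2`, binder-prover seat `ring2-b01`, BINDER-OWNERS row b04/residual (LEAD L38.4 (b)). `HC_CM`
(`Theses.RankFourFaces.CMAbelianHodge`) does not occur in this file; nothing here proves a case of the Hodge conjecture:
every theorem is an implication between the TYPED variational inputs of part I (`Ring2Hypotheses`:
`FlatSectionsAlgebraic`, the flat-section form of Charles–Schnell Conj. 11.3.1 on the espace étalé
`FiberClass f (2p) → S(ℂ)` of `R²ᵖf_*ℂ`; the route item `VHC := Theses.AnchorTransport.VariationalHodge`, stmt-1076,
global-class form) and part XXVII (`Ring2HypothesesFlatSectionsQP`, the two forms on quasi-projective carriers, proved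
equivalent there). No definition, no named fact, no `sorry`.

Part I proved `FlatSectionsAlgebraic ⟹ VHC`, part XXVII `VHC ⟹ FlatSectionsAlgebraicQP`. The residual b04 task is the
converse `VHC ⟹ FlatSectionsAlgebraic` over ALL smooth irreducible bases; both nodes quantify over
`Motives.IsSmoothProjectiveFamily f n` (smooth of relative dimension `n`, PROPER, smooth projective fibres) with `𝒳`
and `S` otherwise arbitrary (`S` smooth irreducible, not assumed separated or quasi-compact). This part removes every
hypothesis on the BASE; all statements PROVED:

* §1 `isHomeomorph_tubeBaseChangeMap_of_isOpenImmersion`, `isCohomologicallyLocallyTrivialOn_range_of_isOpenImmersion`,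
  `exists_section_familyPullback_of_isOpenImmersion` — along an OPEN IMMERSION of bases `g : S' ⟶ S` the tubes of
  `π' = 𝒳 ×_S S' ⟶ S'` and `π` are homeomorphic, Ehresmann's cohomological local triviality DESCENDS from `π'` to `π`
  over `g(S'(ℂ))`, and a continuous section of `FiberClass π k → S(ℂ)` (a flat section of `Rᵏπ_*ℂ`) PULLS BACK to a
  continuous section of `FiberClass π' k → S'(ℂ)` — all WITHOUT the separatedness of `S` asked by the tree's
  `tubeBaseChangeHomeomorph` / `isCohomologicallyLocallyTrivialOn_range_of_familyPullback` (the projection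
  `(𝒳 ×_S S')(ℂ) → 𝒳(ℂ)` is itself an open embedding, SGA1 XII 3.1 (xi)).
* §2 `flatSections_step_of_affine`, `flatSections_of_affine_of_stable`, `flatSectionsAlgebraic_of_affine` — **the
  flat-section node reduces to smooth irreducible AFFINE bases** (for families with any property `Q` stable under
  restriction to opens of the base): the chain of affine opens through closed points of
  `Theorems.forall_complexPoints_of_affineOpens` (route AnchorTransport's reduction for the global-class form), base
  change of the family WITH the section, transport of the Hodge-locus condition, anchor and conclusion across
  `Motives.fiberOverFamilyPullbackIso` (`HodgeTheory/IsoTransport`).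
* §3 **`flatSection_algebraic_of_vhc_of_isQuasiProjectiveOver` — `VHC ⟹` the flat-section transport for every smooth
  projective family WITH QUASI-PROJECTIVE TOTAL SPACE over ANY smooth irreducible base** (`Q 𝒳 := IsQuasiProjectiveOver 𝒳`
  is stable, `Theorems.isQuasiProjectiveOver_familyPullback`; an affine `ℂ`-scheme of finite type is quasi-projective,
  `IsQuasiProjectiveOver.of_isAffine`; then part XXVII's `flatSectionsAlgebraicQP_of_vhc`). BINDER-FREE.

The typed obstruction that remains between §3 and row b04: families whose total space is NOT quasi-projective over an
affine open of the base (smooth proper non-projective morphisms with projective fibres — the Atiyah-flop families of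
`AnchorTransportVariationalHodgeQuasiProjective`); there a flat section becomes a global class only by Deligne's
partie fixe for PROPER smooth morphisms (Hodge II, Thm. 4.1.1 (i)), which the tree holds for projective ones only
(`deligne1968_invariantClass_fromTotalSpace_holds`, `Motives.Voisin2003_invariantCycles`, `deligne_globalInvariantCycles`
— the last through an open immersion into a PROJECTIVE `X̄`). The companion part `Ring2HypothesesFlatSectionsOfPartieFixe`
closes `VHC ⟹ FlatSectionsAlgebraic` modulo that one printed theorem.

References: [CharlesSchnell2014Notes] 11.3.1/11.3.5; [VoisinHodgeII2003] §3.1, Thm. 4.18; [SGA1] XII 3.1 (xi); [DeligneHodgeII1971] 4.1.1.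
-/

-- every declaration of this problem lives in `Summit.HodgeConjecture.HodgeConjecture.…` (summit = sub-problem)
set_option linter.dupNamespace false

noncomputable section

open CategoryTheory AlgebraicGeometry Topology Filter Literature.AlgebraicTopology.SingularHomology
open Literature.AlgebraicGeometry Literature.AlgebraicGeometry.Motives Literature.AlgebraicGeometry.HodgeTheory

namespace Summit.HodgeConjecture.HodgeConjecture.Ring2.Hypotheses

/-! ## §1 Base change along an open immersion: tubes, local triviality, flat sections -/

section OpenImmersion

variable {𝒳 S S' : SchemeOver ℂ} (π : 𝒳 ⟶ S) (g : S' ⟶ S) [IsOpenImmersion g.left]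

/-- The projection `𝒳 ×_S S' ⟶ 𝒳` of a base change along an open immersion is an open immersion. [folklore] -/
theorem isOpenImmersion_familyPullback_fst_left : IsOpenImmersion (familyPullback.fst π g).left :=
  MorphismProperty.of_isPullback (P := @IsOpenImmersion)
    ((familyPullback.isPullback π g).map (Over.forget _)).flip ‹IsOpenImmersion g.left›

omit [IsOpenImmersion g.left] in
/-- Every complex point of the tube `π⁻¹(g V)(ℂ)` is hit by the tube map from `π'⁻¹V(ℂ)`: a point `x` of `𝒳` with
`π x = g v`, `v ∈ V`, is the image of the point `(x, v)` of `𝒳 ×_S S'` (points of a fibre product are compatible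
pairs, `Motives.pullbackOver.pointsEquiv`). [folklore] -/
theorem exists_tubeBaseChangeMap_eq {V : Set (ComplexPoints S')} (x : tubeOver π (AlgPoints.map g '' V)) :
    ∃ x' : tubeOver (familyPullback.snd π g) V, tubeBaseChangeMap π g V x' = x := by
  obtain ⟨v, hv, hvx⟩ := (mem_tubeOver_iff π).1 x.2
  let P : ComplexPoints (familyPullback π g) :=
    (pullbackOver.pointsEquiv π g ℂ).symm ⟨(x.1, v), hvx.symm⟩
  have hP := (pullbackOver.pointsEquiv π g ℂ).apply_symm_apply ⟨(x.1, v), hvx.symm⟩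
  have hfst : AlgPoints.map (familyPullback.fst π g) P = x.1 := congrArg (fun p => (p.1 : _ × _).1) hP
  have hsnd : AlgPoints.map (familyPullback.snd π g) P = v := congrArg (fun p => (p.1 : _ × _).2) hP
  refine ⟨⟨P, ?_⟩, Subtype.ext hfst⟩
  rw [mem_tubeOver_iff, hsnd]
  exact hv

/-- **Along an open immersion of bases the tube map is a homeomorphism** `π'⁻¹V(ℂ) ≃ π⁻¹(g V)(ℂ)`: it is the
restriction of the open embedding `(𝒳 ×_S S')(ℂ) ↪ 𝒳(ℂ)` (SGA1 XII 3.1 (xi), `AlgPoints.isOpenEmbedding_map_holds`),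
which induces the topology, and it is onto (`exists_tubeBaseChangeMap_eq`). No separatedness of `S` (compare the tree's
`tubeBaseChangeHomeomorph`). [cite: SGA1, Exp. XII Prop. 3.1 (xi)] [cite: VoisinHodgeII2003, §3.1.1] -/
theorem isHomeomorph_tubeBaseChangeMap_of_isOpenImmersion (V : Set (ComplexPoints S')) :
    IsHomeomorph (tubeBaseChangeMap π g V) := by
  haveI := isOpenImmersion_familyPullback_fst_left π g
  have hF : IsOpenEmbedding (AlgPoints.map (L := ℂ) (familyPullback.fst π g)) :=
    AlgPoints.isOpenEmbedding_map_holds _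
  have hinj : Function.Injective (tubeBaseChangeMap π g V) := fun a b h =>
    Subtype.ext (hF.injective (congrArg Subtype.val h))
  choose G hG using fun x => exists_tubeBaseChangeMap_eq π g (V := V) x
  rw [isHomeomorph_iff_exists_inverse]
  refine ⟨(tubeBaseChangeMap π g V).continuous, G, fun x' => hinj (hG _), hG, ?_⟩
  have h1 : Continuous fun x => (G x).1 := by
    rw [hF.isInducing.continuous_iff]
    have hc : (AlgPoints.map (L := ℂ) (familyPullback.fst π g)) ∘ (fun x => (G x).1) = Subtype.val :=
      funext fun x => congrArg Subtype.val (hG x)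
    rw [hc]
    exact continuous_subtype_val
  exact h1.subtype_mk _

/-- The tube map along an open immersion induces a bijection on cohomology. [folklore] -/
theorem bijective_map_tubeBaseChangeMap_of_isOpenImmersion (V : Set (ComplexPoints S')) (j : ℕ) :
    Function.Bijective (singularCohomology.map ℂ ℂ (tubeBaseChangeMap π g V) j) := by
  have hT := isHomeomorph_tubeBaseChangeMap_of_isOpenImmersion π g V
  have hce : ((hT.homeomorph _ : _ ≃ₜ _) : C(tubeOver (familyPullback.snd π g) V,
      tubeOver π (AlgPoints.map g '' V))) = tubeBaseChangeMap π g V :=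
    ContinuousMap.ext fun _ => rfl
  rw [← hce]
  exact ConcreteCategory.bijective_of_isIso (singularCohomology.mapIso ℂ ℂ (hT.homeomorph _) j).hom

/-- **Cohomological local triviality descends along an open immersion of bases, `S` arbitrary**: from `π'` over
`S'(ℂ)` to `π` over the open `g(S'(ℂ))` — over `g(B')` restriction to the fibre `X_{g w}` factors as
`(X'_w ≅ X_{g w})^* ∘ (restriction to X'_w) ∘ (tube map)^*` (`map_inv_fiberRestrict_map_tubeBaseChangeMap`), three
bijections (the tree's `isCohomologicallyLocallyTrivialOn_range_of_familyPullback` asks `S` separated).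
[cite: VoisinHodgeII2003, §3.1.1 (p. 69)] [cite: SGA1, Exp. XII Prop. 3.1 (xi)] -/
theorem isCohomologicallyLocallyTrivialOn_range_of_isOpenImmersion
    (h : IsCohomologicallyLocallyTrivialOn (familyPullback.snd π g) (Set.univ : Set (ComplexPoints S'))) :
    IsCohomologicallyLocallyTrivialOn π (Set.range (AlgPoints.map (L := ℂ) g)) := by
  have hg : IsOpenEmbedding (AlgPoints.map (L := ℂ) g) := AlgPoints.isOpenEmbedding_map_holds g
  refine ⟨fun t ht W hW ↦ ?_⟩
  obtain ⟨v, rfl⟩ := ht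
  have hW' : (AlgPoints.map g) ⁻¹' W ∈ 𝓝 v := (AlgPoints.continuous_map g).continuousAt.preimage_mem_nhds hW
  obtain ⟨B', hB'o, hvB', hB'W, -, hbij⟩ := h.exists_nhds_bijective (Set.mem_univ v) _ hW'
  refine ⟨AlgPoints.map g '' B', hg.isOpenMap _ hB'o, Set.mem_image_of_mem _ hvB', ?_,
    Set.image_subset_range _ _, fun j s hs ↦ ?_⟩
  · rintro _ ⟨w, hw, rfl⟩
    exact hB'W hw
  · obtain ⟨w, hw, rfl⟩ := hs
    have hE : Function.Bijective (complexBetti.map (fiberOverFamilyPullbackIso π g w).inv j) :=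
      complexBetti.bijective_map_of_iso (fiberOverFamilyPullbackIso π g w).symm j
    have hB : Function.Bijective fun ζ => complexBetti.map (fiberOverFamilyPullbackIso π g w).inv j
        (fiberRestrict (familyPullback.snd π g) hw j
          (singularCohomology.map ℂ ℂ (tubeBaseChangeMap π g B') j ζ)) :=
      hE.comp ((hbij j hw).comp (bijective_map_tubeBaseChangeMap_of_isOpenImmersion π g B' j))
    have key : (fiberRestrict π (Set.mem_image_of_mem _ hw) j :
        singularCohomology ℂ ℂ (tubeOver π (AlgPoints.map g '' B')) j → _) =
        fun ζ => complexBetti.map (fiberOverFamilyPullbackIso π g w).inv j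
          (fiberRestrict (familyPullback.snd π g) hw j
            (singularCohomology.map ℂ ℂ (tubeBaseChangeMap π g B') j ζ)) :=
      funext fun ζ => (map_inv_fiberRestrict_map_tubeBaseChangeMap π g j ζ hw).symm
    rw [key]
    exact hB

/-- **Pull-back of a flat section along an open immersion of bases** `g : S' ⟶ S` (`π' = familyPullback.snd π g`
cohomologically locally trivial over `S'(ℂ)`, by Ehresmann): every continuous section `σ` of `FiberClass π k → S(ℂ)`
(a global section of `Rᵏπ_*ℂ`) lifts to a continuous section `σ'(u) = (u, (X'_u ≅ X_{g u})^* σ(g u))` of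
`FiberClass π' k → S'(ℂ)` with `FiberClass.baseChange ∘ σ' = σ ∘ g(ℂ)`. Continuity: near `g u₀`, `σ` is the sheet of a
tube class `ξ` (`FiberClass.eventually_eq_tubeSection` over the descended local triviality) and `σ'` is the sheet of
`pr^* ξ`. No separatedness of `S`. (Same content landed in parallel as `HodgeTheory.FiberClass.exists_section_familyPullback_of_isOpenImmersion`
— count once.) [cite: VoisinHodgeII2003, §3.1.1 and §3.1.2] [cite: VoisinHodgeI2002, §9.2.1] -/
theorem exists_section_familyPullback_of_isOpenImmersion (k : ℕ)
    (hU' : IsCohomologicallyLocallyTrivialOn (familyPullback.snd π g) (Set.univ : Set (ComplexPoints S')))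
    {σ : ComplexPoints S → FiberClass π k} (hσ : Continuous σ) (hpt : ∀ s, (σ s).pt = s) :
    ∃ σ' : ComplexPoints S' → FiberClass (familyPullback.snd π g) k,
      Continuous σ' ∧ (∀ u, (σ' u).pt = u) ∧
        ∀ u, FiberClass.baseChange π g k (σ' u) = σ (AlgPoints.map g u) := by
  let e : ∀ u : ComplexPoints S',
      fiberOver (familyPullback.snd π g) u ≅ fiberOver π (AlgPoints.map g u) :=
    fun u => fiberOverFamilyPullbackIso π g u
  let σ' : ComplexPoints S' → FiberClass (familyPullback.snd π g) k := fun u =>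
    ⟨u, complexBetti.map (e u).hom k ((σ (AlgPoints.map g u)).clsAt (hpt _))⟩
  have hσ'g : ∀ u, FiberClass.baseChange π g k (σ' u) = σ (AlgPoints.map g u) := fun u => by
    change (⟨AlgPoints.map g u, complexBetti.map (e u).inv k
      (complexBetti.map (e u).hom k ((σ (AlgPoints.map g u)).clsAt (hpt _)))⟩ : FiberClass π k) = _
    rw [(e u).complexBetti_map_inv_map_hom, FiberClass.mk_clsAt]
  refine ⟨σ', ?_, fun _ => rfl, hσ'g⟩
  -- continuity at `u₀`
  have hO := isCohomologicallyLocallyTrivialOn_range_of_isOpenImmersion π g hU'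
  have hgc : Continuous (AlgPoints.map (L := ℂ) g) := AlgPoints.continuous_map g
  refine continuous_iff_continuousAt.2 fun u₀ => ?_
  obtain ⟨B, hBo, hB₀, -, hBsub, hbij⟩ :=
    hO.exists_nhds_bijective (Set.mem_range_self u₀) Set.univ Filter.univ_mem
  have h₀ : (σ (AlgPoints.map g u₀)).pt ∈ B := by rw [hpt]; exact hB₀
  obtain ⟨ξ, -, hev⟩ :=
    FiberClass.eventually_eq_tubeSection π k hO hσ.continuousAt hBo hBsub h₀ (hbij k h₀)
  have hev' : ∀ᶠ u in 𝓝 u₀, ∃ hB : (σ (AlgPoints.map g u)).pt ∈ B,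
      σ (AlgPoints.map g u) = tubeSection π k B ξ ⟨(σ (AlgPoints.map g u)).pt, hB⟩ :=
    hgc.continuousAt.eventually hev
  -- the pulled-back tube class over `B' = g⁻¹ B`
  set B' : Set (ComplexPoints S') := AlgPoints.map g ⁻¹' B with hB'def
  have hB'o : IsOpen B' := hBo.preimage hgc
  have himg : AlgPoints.map g '' B' ⊆ B := Set.image_preimage_subset _ _
  set ξ' : singularCohomology ℂ ℂ (tubeOver (familyPullback.snd π g) B') k :=
    singularCohomology.map ℂ ℂ (tubeBaseChangeMap π g B') k
      (singularCohomology.map ℂ ℂ (tubeInclusion π himg) k ξ) with hξ'def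
  refine FiberClass.continuousAt_of_eventually_eq_tubeSection continuousAt_id hB'o ξ' ?_
  filter_upwards [hev', hB'o.mem_nhds (show u₀ ∈ B' from hB₀)] with u hu huB'
  obtain ⟨hB, hu⟩ := hu
  refine ⟨huB', ?_⟩
  have hgu : AlgPoints.map g u ∈ B := huB'
  have hsub : (⟨(σ (AlgPoints.map g u)).pt, hB⟩ : B) = ⟨AlgPoints.map g u, hgu⟩ := Subtype.ext (hpt _)
  have hcls : (σ (AlgPoints.map g u)).clsAt (hpt _) = fiberRestrict π hgu k ξ := by
    rw [FiberClass.clsAt_eq_iff]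
    exact hu.trans (congrArg (tubeSection π k B ξ) hsub)
  have key := map_inv_fiberRestrict_map_tubeBaseChangeMap π g k
    (singularCohomology.map ℂ ℂ (tubeInclusion π himg) k ξ) huB'
  rw [fiberRestrict_map_tubeInclusion] at key
  change (⟨u, complexBetti.map (e u).hom k ((σ (AlgPoints.map g u)).clsAt (hpt _))⟩ :
      FiberClass (familyPullback.snd π g) k) = ⟨u, fiberRestrict (familyPullback.snd π g) huB' k ξ'⟩
  rw [hcls, FiberClass.mk_eq_mk_iff, ← key, (e u).complexBetti_map_hom_map_inv]

end OpenImmersion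

/-! ## §2 Reduction of the flat-section node to affine bases -/

section Affine

/-- **One step inside an affine open, flat-section form, for `Q`-families** (`Q` stable under base change along open
immersions of the base; `Q = ⊤` for the node as filed, `Q f := IsQuasiProjectiveOver 𝒳` in §3): restrict the family to
the affine open `U` (`Motives.openSubschemeOver`: affine, irreducible, smooth — hence separated and quasi-compact, so
`Rᵏπ'_*ℂ` is a local system by Ehresmann, `isCohomologicallyLocallyTrivialOn_univ_of_smooth`), lift `a`, `b` to `U`,
pull the section back (`exists_section_familyPullback_of_isOpenImmersion`), move the Hodge-locus condition and the anchor
up and the conclusion down along `FiberClass.baseChange` and the fibre isomorphisms (`HodgeTheory/IsoTransport`).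
[folklore] -/
theorem flatSections_step_of_affine (Q : ∀ ⦃𝒳 S : SchemeOver ℂ⦄, (𝒳 ⟶ S) → Prop)
    (hQ : ∀ ⦃𝒳 S S' : SchemeOver ℂ⦄ (f : 𝒳 ⟶ S) (g : S' ⟶ S), IsOpenImmersion g.left →
      Q f → Q (familyPullback.snd f g))
    (h : ∀ ⦃n : ℕ⦄ ⦃𝒳 S : SchemeOver ℂ⦄ (f : 𝒳 ⟶ S), IsSmoothProjectiveFamily f n → Q f →
      IrreducibleSpace S.left → IsAffine S.left → AlgebraicGeometry.Smooth S.hom →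
      ∀ (p : ℕ) (σ : ComplexPoints S → FiberClass f (2 * p)),
      Continuous σ → (∀ s, (σ s).pt = s) → (∀ s, σ s ∈ locusOfHodgeClasses f n p) →
      (∃ s₀, (σ s₀).cls ∈ algebraicClasses (fiberOver f (σ s₀).pt) p) →
      ∀ s, (σ s).cls ∈ algebraicClasses (fiberOver f (σ s).pt) p)
    {n : ℕ} {𝒳 S : SchemeOver ℂ} (f : 𝒳 ⟶ S) (hf : IsSmoothProjectiveFamily f n) (hQf : Q f)
    [IrreducibleSpace S.left] [AlgebraicGeometry.Smooth S.hom] (p : ℕ)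
    (σ : ComplexPoints S → FiberClass f (2 * p)) (hσ : Continuous σ) (hpt : ∀ s, (σ s).pt = s)
    (hH : ∀ s, σ s ∈ locusOfHodgeClasses f n p)
    (U : S.left.Opens) (hU : IsAffineOpen U) (a b : ComplexPoints S) (haU : a.pt ∈ U) (hbU : b.pt ∈ U)
    (ha : (σ a).cls ∈ algebraicClasses (fiberOver f (σ a).pt) p) :
    (σ b).cls ∈ algebraicClasses (fiberOver f (σ b).pt) p := by
  -- the affine open `U` as a smooth irreducible affine (hence separated, quasi-compact) `ℂ`-scheme `ι : U ⟶ S`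
  set ι := openSubschemeOverι S U with hιdef
  haveI : IsOpenImmersion ι.left := inferInstanceAs (IsOpenImmersion U.ι)
  haveI hUaff : IsAffine (openSubschemeOver S U).left := hU
  have hUirr : IrreducibleSpace (openSubschemeOver S U).left := by
    change IrreducibleSpace U
    exact isIrreducible_iff_irreducibleSpace.mp ⟨⟨a.pt, haU⟩,
      (PreirreducibleSpace.isPreirreducible_univ (X := S.left)).open_subset U.isOpen
        (Set.subset_univ _)⟩
  haveI hUsm : AlgebraicGeometry.Smooth (openSubschemeOver S U).hom := by
    change AlgebraicGeometry.Smooth (U.ι ≫ S.hom)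
    infer_instance
  haveI : IsSeparated (openSubschemeOver S U).hom := inferInstance
  haveI : CompactSpace (openSubschemeOver S U).left :=
    isCompact_iff_compactSpace.mp hU.isCompact
  -- lift `a`, `b` to `U`
  have hrange : Set.range (AlgPoints.map (L := ℂ) ι) = {P | P.pt ∈ U} := by
    rw [AlgPoints.range_map_of_isOpenImmersion_holds]
    ext P
    change P.pt ∈ U.ι.opensRange ↔ P.pt ∈ U
    rw [Scheme.Opens.opensRange_ι]
  obtain ⟨a', rfl⟩ : a ∈ Set.range (AlgPoints.map (L := ℂ) ι) := by rw [hrange]; exact haU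
  obtain ⟨b', rfl⟩ : b ∈ Set.range (AlgPoints.map (L := ℂ) ι) := by rw [hrange]; exact hbU
  -- the restricted family, its local system, and the pulled-back section
  have hf' : IsSmoothProjectiveFamily (familyPullback.snd f ι) n := hf.familyPullback_snd ι
  have hU' : IsCohomologicallyLocallyTrivialOn (familyPullback.snd f ι)
      (Set.univ : Set (ComplexPoints (openSubschemeOver S U))) :=
    isCohomologicallyLocallyTrivialOn_univ_of_smooth _ hf'
  obtain ⟨σ', hσ'c, hσ'pt, hσ'g⟩ := exists_section_familyPullback_of_isOpenImmersion f ι (2 * p) hU' hσ hpt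
  -- the fibre isomorphisms `e u : X'_u ≅ X_{ι u}`
  have hdown : ∀ u, σ (AlgPoints.map ι u) =
      ⟨AlgPoints.map ι (σ' u).pt,
        complexBetti.map (fiberOverFamilyPullbackIso f ι (σ' u).pt).inv (2 * p) (σ' u).cls⟩ :=
    fun u => (hσ'g u).symm
  -- Hodge-locus condition upstairs
  have hH' : ∀ u, σ' u ∈ locusOfHodgeClasses (familyPullback.snd f ι) n p := fun u => by
    have hx := fiberClass_transfer_of_eq_mk (hdown u)
      (fun t c => IsRationalClass c ∧ IsOfHodgeType n (fiberOver f t) (2 * p) p p c)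
      ((mem_locusOfHodgeClasses_iff _).1 (hH _))
    exact (mem_locusOfHodgeClasses_iff _).2
      ⟨(isRationalClass_map_iff_of_iso (fiberOverFamilyPullbackIso f ι (σ' u).pt).symm).1 hx.1,
        (isOfHodgeType_map_iff_of_iso (n := n) (fiberOverFamilyPullbackIso f ι (σ' u).pt).symm).1 hx.2⟩
  -- the anchor upstairs
  have ha' : (σ' a').cls ∈ algebraicClasses (fiberOver (familyPullback.snd f ι) (σ' a').pt) p := by
    have hx := fiberClass_transfer_of_eq_mk (hdown a') (fun t c => c ∈ algebraicClasses (fiberOver f t) p) ha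
    exact (mem_algebraicClasses_map_iff_of_iso (fiberOverFamilyPullbackIso f ι (σ' a').pt).symm).1 hx
  -- the affine statement upstairs, and back down
  have hb' := h (familyPullback.snd f ι) hf' (hQ f ι inferInstance hQf) hUirr hUaff hUsm p σ' hσ'c hσ'pt hH'
    ⟨a', ha'⟩ b'
  exact fiberClass_transfer_to_eq_mk (hdown b') (fun t c => c ∈ algebraicClasses (fiberOver f t) p)
    ((mem_algebraicClasses_map_iff_of_iso (fiberOverFamilyPullbackIso f ι (σ' b').pt).symm).2 hb')

/-- **Reduction to affine bases for `Q`-families, flat-section form** (`Theorems.forall_complexPoints_of_affineOpens`: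
two complex points of an irreducible `ℂ`-scheme locally of finite type are joined by a chain of affine opens meeting in
closed points; and `flatSections_step_of_affine`). [folklore] -/
theorem flatSections_of_affine_of_stable (Q : ∀ ⦃𝒳 S : SchemeOver ℂ⦄, (𝒳 ⟶ S) → Prop)
    (hQ : ∀ ⦃𝒳 S S' : SchemeOver ℂ⦄ (f : 𝒳 ⟶ S) (g : S' ⟶ S), IsOpenImmersion g.left →
      Q f → Q (familyPullback.snd f g))
    (h : ∀ ⦃n : ℕ⦄ ⦃𝒳 S : SchemeOver ℂ⦄ (f : 𝒳 ⟶ S), IsSmoothProjectiveFamily f n → Q f →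
      IrreducibleSpace S.left → IsAffine S.left → AlgebraicGeometry.Smooth S.hom →
      ∀ (p : ℕ) (σ : ComplexPoints S → FiberClass f (2 * p)),
      Continuous σ → (∀ s, (σ s).pt = s) → (∀ s, σ s ∈ locusOfHodgeClasses f n p) →
      (∃ s₀, (σ s₀).cls ∈ algebraicClasses (fiberOver f (σ s₀).pt) p) →
      ∀ s, (σ s).cls ∈ algebraicClasses (fiberOver f (σ s).pt) p)
    ⦃n : ℕ⦄ ⦃𝒳 S : SchemeOver ℂ⦄ (f : 𝒳 ⟶ S) (hf : IsSmoothProjectiveFamily f n) (hQf : Q f)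
    (hirr : IrreducibleSpace S.left) (hsm : AlgebraicGeometry.Smooth S.hom) (p : ℕ)
    (σ : ComplexPoints S → FiberClass f (2 * p)) (hσ : Continuous σ) (hpt : ∀ s, (σ s).pt = s)
    (hH : ∀ s, σ s ∈ locusOfHodgeClasses f n p)
    (h₀ : ∃ s₀, (σ s₀).cls ∈ algebraicClasses (fiberOver f (σ s₀).pt) p) (s : ComplexPoints S) :
    (σ s).cls ∈ algebraicClasses (fiberOver f (σ s).pt) p := by
  obtain ⟨s₀, hs₀⟩ := h₀
  haveI := hirr
  haveI := hsm
  exact Theorems.forall_complexPoints_of_affineOpens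
    (fun t => (σ t).cls ∈ algebraicClasses (fiberOver f (σ t).pt) p)
    (fun U hU a b haU hbU ha => flatSections_step_of_affine Q hQ h f hf hQf p σ hσ hpt hH U hU a b haU hbU ha)
    hs₀ s

/-- **The flat-section node reduces to affine bases** (`Q = ⊤`): if the flat-section form of Conj. 11.3.1 holds for
smooth projective families over smooth irreducible AFFINE `ℂ`-schemes, then `FlatSectionsAlgebraic` (all smooth
irreducible bases; neither separatedness nor quasi-compactness of the base is needed). [cite: CharlesSchnell2014Notes, Conj. 11.3.1] -/
theorem flatSectionsAlgebraic_of_affine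
    (h : ∀ ⦃n : ℕ⦄ ⦃𝒳 S : SchemeOver ℂ⦄ (f : 𝒳 ⟶ S), IsSmoothProjectiveFamily f n →
      IrreducibleSpace S.left → IsAffine S.left → AlgebraicGeometry.Smooth S.hom →
      ∀ (p : ℕ) (σ : ComplexPoints S → FiberClass f (2 * p)),
      Continuous σ → (∀ s, (σ s).pt = s) → (∀ s, σ s ∈ locusOfHodgeClasses f n p) →
      (∃ s₀, (σ s₀).cls ∈ algebraicClasses (fiberOver f (σ s₀).pt) p) →
      ∀ s, (σ s).cls ∈ algebraicClasses (fiberOver f (σ s).pt) p) :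
    FlatSectionsAlgebraic :=
  fun _ _ _ f hf hirr hsm p σ hσ hpt hH h₀ s =>
    flatSections_of_affine_of_stable (fun _ _ _ => True) (fun _ _ _ _ _ _ _ => trivial)
      (fun _ _ _ f hf _ hirr haff hsm => h f hf hirr haff hsm) f hf trivial hirr hsm p σ hσ hpt hH h₀ s

end Affine

/-! ## §3 Quasi-projective total spaces over ANY smooth irreducible base -/

/-- **`FlatSectionsAlgebraicQP` already gives the flat-section transport for quasi-projective total spaces over every
smooth irreducible base** — the quasi-projectivity of the BASE in part XXVII's node is superfluous (the base is not
assumed quasi-projective, separated or quasi-compact): reduce to affine bases (`flatSections_of_affine_of_stable` with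
`Q 𝒳 := IsQuasiProjectiveOver 𝒳`, stable by `Theorems.isQuasiProjectiveOver_familyPullback`), which are
quasi-projective (`IsQuasiProjectiveOver.of_isAffine`). [cite: CharlesSchnell2014Notes, Conj. 11.3.1] -/
theorem flatSection_algebraic_of_flatSectionsAlgebraicQP_of_isQuasiProjectiveOver (hF : FlatSectionsAlgebraicQP)
    ⦃n : ℕ⦄ ⦃𝒳 S : SchemeOver ℂ⦄ (f : 𝒳 ⟶ S) (hf : IsSmoothProjectiveFamily f n)
    (h𝒳 : IsQuasiProjectiveOver 𝒳) (hirr : IrreducibleSpace S.left) (hsm : AlgebraicGeometry.Smooth S.hom)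
    (p : ℕ) (σ : ComplexPoints S → FiberClass f (2 * p)) (hσ : Continuous σ) (hpt : ∀ s, (σ s).pt = s)
    (hH : ∀ s, σ s ∈ locusOfHodgeClasses f n p)
    (h₀ : ∃ s₀, (σ s₀).cls ∈ algebraicClasses (fiberOver f (σ s₀).pt) p) (s : ComplexPoints S) :
    (σ s).cls ∈ algebraicClasses (fiberOver f (σ s).pt) p :=
  flatSections_of_affine_of_stable (fun 𝒳 _ _ => IsQuasiProjectiveOver 𝒳)
    (fun _ _ _ f g hg hq => Theorems.isQuasiProjectiveOver_familyPullback f g hg hq)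
    (fun _ _ S f hf hq hirr haff hsm p σ hσ hpt hH h₀ s => by
      haveI := haff
      haveI := hsm
      haveI : LocallyOfFiniteType S.hom := inferInstance
      exact hF f hf hq (IsQuasiProjectiveOver.of_isAffine S) hirr hsm p σ hσ hpt hH h₀ s)
    f hf h𝒳 hirr hsm p σ hσ hpt hH h₀ s

/-- **RUNG (row b04). `VHC ⟹` flat-section transport, quasi-projective total space, ANY smooth irreducible base** (no
binder, no named fact): for `f : 𝒳 ⟶ S` smooth of relative dimension `n`, proper, with smooth projective fibres, `𝒳`
quasi-projective over `ℂ`, `S` smooth and irreducible (NOT assumed quasi-projective, separated or quasi-compact), and a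
flat section `σ` of `R²ᵖf_*ℂ` valued in the locus of Hodge classes: algebraic at one `s₀` ⟹ algebraic at every `s`,
granted the global-class form `VHC` (item stmt-HodgeConjecture-1076) — through part XXVII's `flatSectionsAlgebraicQP_of_vhc`
(Deligne 1968 on the printed carriers, a tree THEOREM) and the lemma above. The body is that of `FlatSectionsAlgebraic`
with ONE extra carrier clause (`IsQuasiProjectiveOver 𝒳`): the typed residual of row b04 (module docstring).
[cite: CharlesSchnell2014Notes, Conj. 11.3.1 and proof of Prop. 11.3.5] [cite: VoisinHodgeII2003, Thm. 4.18] -/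
theorem flatSection_algebraic_of_vhc_of_isQuasiProjectiveOver (hV : Theses.AnchorTransport.VariationalHodge)
    ⦃n : ℕ⦄ ⦃𝒳 S : SchemeOver ℂ⦄ (f : 𝒳 ⟶ S) (hf : IsSmoothProjectiveFamily f n)
    (h𝒳 : IsQuasiProjectiveOver 𝒳) (hirr : IrreducibleSpace S.left) (hsm : AlgebraicGeometry.Smooth S.hom)
    (p : ℕ) (σ : ComplexPoints S → FiberClass f (2 * p)) (hσ : Continuous σ) (hpt : ∀ s, (σ s).pt = s)
    (hH : ∀ s, σ s ∈ locusOfHodgeClasses f n p)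
    (h₀ : ∃ s₀, (σ s₀).cls ∈ algebraicClasses (fiberOver f (σ s₀).pt) p) (s : ComplexPoints S) :
    (σ s).cls ∈ algebraicClasses (fiberOver f (σ s).pt) p :=
  flatSection_algebraic_of_flatSectionsAlgebraicQP_of_isQuasiProjectiveOver (flatSectionsAlgebraicQP_of_vhc hV) f hf
    h𝒳 hirr hsm p σ hσ hpt hH h₀ s

/-- ON-PATH: the summit gives the rung (through `vhc_of_hodgeConjecture`). [cite: CharlesSchnell2014Notes, Cor. 11.3.6] -/
theorem flatSection_algebraic_of_hodgeConjecture_of_isQuasiProjectiveOver (hHC : _root_.HodgeConjecture)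
    ⦃n : ℕ⦄ ⦃𝒳 S : SchemeOver ℂ⦄ (f : 𝒳 ⟶ S) (hf : IsSmoothProjectiveFamily f n)
    (h𝒳 : IsQuasiProjectiveOver 𝒳) (hirr : IrreducibleSpace S.left) (hsm : AlgebraicGeometry.Smooth S.hom)
    (p : ℕ) (σ : ComplexPoints S → FiberClass f (2 * p)) (hσ : Continuous σ) (hpt : ∀ s, (σ s).pt = s)
    (hH : ∀ s, σ s ∈ locusOfHodgeClasses f n p)
    (h₀ : ∃ s₀, (σ s₀).cls ∈ algebraicClasses (fiberOver f (σ s₀).pt) p) (s : ComplexPoints S) :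
    (σ s).cls ∈ algebraicClasses (fiberOver f (σ s).pt) p :=
  flatSection_algebraic_of_vhc_of_isQuasiProjectiveOver (vhc_of_hodgeConjecture hHC) f hf h𝒳 hirr hsm p σ hσ hpt
    hH h₀ s
/-! ## Audit: no named fact, no definition, no `sorry`; `HC_CM` does not occur; standard axioms only. -/

#print axioms Summit.HodgeConjecture.HodgeConjecture.Ring2.Hypotheses.exists_section_familyPullback_of_isOpenImmersion
#print axioms Summit.HodgeConjecture.HodgeConjecture.Ring2.Hypotheses.flatSectionsAlgebraic_of_affine
#print axioms Summit.HodgeConjecture.HodgeConjecture.Ring2.Hypotheses.flatSection_algebraic_of_vhc_of_isQuasiProjectiveOver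

end Summit.HodgeConjecture.HodgeConjecture.Ring2.Hypotheses

end
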